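import Summits.QuantumFields.YangMills.Theorems.BalabanUVNodesN20KeyedRelWeightCanonical
import Summits.QuantumFields.YangMills.Theorems.BalabanUVNodesN20KeyedRelWeightPolicyWall

/-!
# BalabanUVNodes ∕ N20 (NE7b) — THE CUT DIAL READ ON THE PERSISTENT-ACTIVITY FRACTION OF RECORD IS MONOTONE AND SATURATES: `W(jcut) K` is non-decreasing in `jcut K`, depends on
# `jcut K` only through `min (jcut K) (K₀ + K + 1)`, and the N20 face at the reading transfers DOWN the dial (a deeper cut is the stronger statement)

Cell `pub-ymgap` (HUMAN RULING D-0062 Track A; work-bound push D-0149, director-ym №197), width seat `pub-ymgap-dag-n20-w2` (gen 2); CLAIM-6 of the re-seat — the canonical-weight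
form of dag-n20-w3's monotone interior of the dial (`relWeightBound_badKeysSigma_of_policy_le`, generic carriers, GLOBAL policy comparison) and of dag-n20-w1's AT-ONE-STEP comparison
(`badClass₁₃_mono_at`, p597932), on this seat's `W` of CLAIM-2; offered to dag-n20-w1 g3 on the bus (l.27403 ∕ l.28019), not taken before its ■ (l.27826), so typed here with both
CITED.  Filed `--kind proof --supports stmt-QuantumFields-20544 --as helper` (K3⁷); COUNT-NEUTRAL; LOCATED.  [LF-II] = [Balaban1989LargeFieldII].

WHAT IS PROVED (bookkeeping; 0 `sorry`):
* §0 (generic `ι`, ONE step `K`) `admW_subset_admW_of_subset_at` · `one_mem_admW_at` · `wInf_mono_of_subset_at` (the step-`K` slices of CLAIM-2's `admW_subset_admW_of_subset` ∕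
  `wInf_mono_of_subset`: `wInf … K` reads step `K` only);
* §1 ★ `W_crOfRecord₁₃VAt_mono_at` (`jcut K ≤ jcut' K ⇒ W(jcut) K ≤ W(jcut') K` at every tuple with core provisos — hypothesis-free) · `W_crOfRecord₁₃VAt_congr_at` · `…At…` twins;
* §2 NORMAL FORM: `keyOldLargeField_min_length_succ_iff` (a key of the class set at step `K` is old-bad at `j` iff at `min j (K₀ + K + 1)` — the normalisation `Λ_{K₀+K+1} = ∅`,
  CLAIM-1's `keyOldLargeField_of_mem_classSet₁₃_of_lt`) · `badClass₁₃_eq_badClass₁₃_min` · ★ `W_crOfRecord₁₃VAt_eq_W_min` (`W(jcut) K = W(fun K ↦ min (jcut K) (K₀ + K + 1)) K`):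
  above the window the dial is FLAT (and `= 1` on a live tuple, CLAIM-2's `W_crOfRecord₁₃VAt_eq_one_of_overCut`);
* §3 ★★ `relWeightBound_crOfRecord₁₃VAt_anti` (the N20 face at the reading at policy `jcut'` implies it at every `jcut ≤ jcut'` pointwise — same reading, canonical weights; CLAIM-2's
  iff + §1 + `Summable.of_nonneg_of_le`): a stub-2 witness at a deeper cut is a witness at every shallower one — the face is ANTITONE in the dial, so with gen 0's free zero end and
  CLAIM-1's excluded over-cut end the cut readings carrying N20 on a live tuple form a DOWN-SET of the window `[0, K₀ + K]`, step by step.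
HONEST FRAMING.  Bookkeeping BY NAME; NO estimate; LOCATED, count-neutral; nothing of Bałaban's asserted; NE7 ∕ NE7b ∕ NE7c NOT PRINTED for `d = 4`, NOT proved; (α)-instance 0∕1; N19 ∕
N20 ∕ N21 ∕ N27 NOT discharged; K3⁷ NOT closed; counts unmoved (typed 28∕28 · discharged 5∕27); no count claim.  One finite `𝕋⁴_{L^K}` programme at fixed `ε = L^{−K}`, Bałaban AS
PRINTED; the YM mass gap (Clay) is NOT proved by any of this — R4 closes the conditional finite-𝕋⁴ rung `BalabanLadder.UV` only; NOT ℝ⁴, NOT infinite volume, NOT OS.  No `def`, no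
`instance`, no `notation`, no `sorry`.  Sources (locators, bookkeeping only): [LF-II] Thm 1 + (0.1) pp.355–356, (1.80) p.384; [King1986] (3.10)–(3.11) p.656.
-/

noncomputable section

open scoped BigOperators

namespace Summit.QuantumFields.YangMills.BalabanUVNodes.N20KeyedRelWeightDialMonotone

open Literature.MathematicalPhysics.QuantumFieldTheory.Balaban1983to89 Literature.MathematicalPhysics.QuantumFieldTheory.Balaban1983to89.Node00
open T4Continuum
open T4WeightBudget (RelWeightBound)
open YMDAG.UVSplit hiding SU
open Summit.QuantumFields.YangMills.BalabanUVNodes.SpineCanonicalWeights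
open Summit.QuantumFields.YangMills.BalabanUVNodes.N21KeyedShellWeightShellZero (weightA₁₃_nonneg weightB₁₃_nonneg)
open Summit.QuantumFields.YangMills.BalabanUVNodes.N20KeyedRelWeightPolicyWall (mem_badClass₁₃_iff badClass₁₃_mono_at badClass₁₃_congr_at)
open Summit.QuantumFields.YangMills.BalabanUVNodes.N20KeyedRelWeightOverCut (keyOldLargeField_of_mem_classSet₁₃_of_lt)
open Summit.QuantumFields.YangMills.BalabanUVNodes.N20KeyedRelWeightCanonical

/-! ## §0  Folklore at ONE step: the canonical weight at step `K` reads the step-`K` classes only -/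

section Generic

variable {ι : Type*} {l₀ : ℝ} {T : ℕ → Finset ι} {A B : ℕ → ℝ → ι → ℝ} {Bad Bad' : ℕ → ℝ → Finset ι} {K : ℕ}

/-- A larger class AT STEP `K` has fewer admissible weights at step `K` (non-negative terms on `T K`). [cite: King1986, (3.10)–(3.11) p.656 (bookkeeping)] -/
theorem admW_subset_admW_of_subset_at (hA : ∀ t : ℝ, |t| ≤ l₀ → ∀ τ ∈ T K, 0 ≤ A K t τ) (hB : ∀ t : ℝ, |t| ≤ l₀ → ∀ τ ∈ T K, 0 ≤ B K t τ)
    (hBB : ∀ t : ℝ, |t| ≤ l₀ → Bad K t ⊆ Bad' K t) (hsub' : ∀ t : ℝ, |t| ≤ l₀ → Bad' K t ⊆ T K) :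
    admW l₀ T A B Bad' K ⊆ admW l₀ T A B Bad K := fun _ hw =>
  ⟨hw.1, fun t ht =>
    ⟨(Finset.sum_le_sum_of_subset_of_nonneg (hBB t ht) fun τ hτ _ => hA t ht τ (hsub' t ht hτ)).trans (hw.2 t ht).1,
      (Finset.sum_le_sum_of_subset_of_nonneg (hBB t ht) fun τ hτ _ => hB t ht τ (hsub' t ht hτ)).trans (hw.2 t ht).2⟩⟩

/-- The weight `1` is admissible at step `K` (non-negative terms, `Bad K t ⊆ T K`). [cite: King1986, (3.10)–(3.11) p.656 (bookkeeping)] -/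
theorem one_mem_admW_at (hA : ∀ t : ℝ, |t| ≤ l₀ → ∀ τ ∈ T K, 0 ≤ A K t τ) (hB : ∀ t : ℝ, |t| ≤ l₀ → ∀ τ ∈ T K, 0 ≤ B K t τ)
    (hsub : ∀ t : ℝ, |t| ≤ l₀ → Bad K t ⊆ T K) : (1 : ℝ) ∈ admW l₀ T A B Bad K := by
  refine ⟨zero_le_one, fun t ht => ⟨?_, ?_⟩⟩
  · rw [one_mul]; exact Finset.sum_le_sum_of_subset_of_nonneg (hsub t ht) fun τ hτ _ => hA t ht τ hτ
  · rw [one_mul]; exact Finset.sum_le_sum_of_subset_of_nonneg (hsub t ht) fun τ hτ _ => hB t ht τ hτ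

/-- **THE CANONICAL WEIGHT IS MONOTONE IN THE STEP-`K` CLASS**: `Bad K · ⊆ Bad' K · ⊆ T K` ⇒ `wInf … Bad K ≤ wInf … Bad' K`. [cite: King1986, (3.10)–(3.11) p.656 (bookkeeping)] -/
theorem wInf_mono_of_subset_at (hA : ∀ t : ℝ, |t| ≤ l₀ → ∀ τ ∈ T K, 0 ≤ A K t τ) (hB : ∀ t : ℝ, |t| ≤ l₀ → ∀ τ ∈ T K, 0 ≤ B K t τ)
    (hBB : ∀ t : ℝ, |t| ≤ l₀ → Bad K t ⊆ Bad' K t) (hsub' : ∀ t : ℝ, |t| ≤ l₀ → Bad' K t ⊆ T K) :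
    wInf l₀ T A B Bad K ≤ wInf l₀ T A B Bad' K :=
  wInf_le_of_mem (admW_subset_admW_of_subset_at hA hB hBB hsub' (wInf_mem_of_nonempty ⟨1, one_mem_admW_at hA hB hsub'⟩))

end Generic

/-! ## §1  At the reading of record: a deeper cut at step `K` gives a larger persistent-activity fraction at step `K` -/

section Reading

variable {F : T4Family} {N : ℕ} [NeZero N] (θ : Stage13HParams F N) (hP : θ.Provisos₁₃CoPH F N) (K₀ : ℕ) (g₀ : ℕ → ℝ) (os : List (ULoop F)) (sh : ShellSplit₁₃CoPH N K₀)

/-- **★ `jcut K ≤ jcut' K ⇒ W(jcut) K ≤ W(jcut') K`** at `crOfRecord₁₃VAt K₀ · sh …`, every Stage-13 tuple with core provisos, hypothesis-free (dag-n20-w1's `badClass₁₃_mono_at` + §0).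
[cite: Balaban1989LargeFieldII, (1.80) p.384; King1986, (3.10)–(3.11) p.656 (bookkeeping)] -/
theorem W_crOfRecord₁₃VAt_mono_at {jcut jcut' : ℕ → ℕ} {K : ℕ} (h : jcut K ≤ jcut' K) :
    (crOfRecord₁₃VAt K₀ jcut sh F θ hP g₀ os).W K ≤ (crOfRecord₁₃VAt K₀ jcut' sh F θ hP g₀ os).W K :=
  wInf_mono_of_subset_at (fun t _ x _ => weightA₁₃_nonneg F θ hP K₀ g₀ os K t x) (fun t _ x _ => weightB₁₃_nonneg F θ hP K₀ g₀ os K t x)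
    (fun t _ => badClass₁₃_mono_at θ K₀ g₀ h t) (fun t _ => badClass₁₃_subset θ K₀ g₀ jcut' K t)

/-- **… so two policies agreeing at step `K` have the same fraction at step `K`.** [cite: Balaban1989LargeFieldII, (1.80) p.384 (bookkeeping)] -/
theorem W_crOfRecord₁₃VAt_congr_at {jcut jcut' : ℕ → ℕ} {K : ℕ} (h : jcut K = jcut' K) :
    (crOfRecord₁₃VAt K₀ jcut sh F θ hP g₀ os).W K = (crOfRecord₁₃VAt K₀ jcut' sh F θ hP g₀ os).W K :=
  le_antisymm (W_crOfRecord₁₃VAt_mono_at θ hP K₀ g₀ os sh h.le) (W_crOfRecord₁₃VAt_mono_at θ hP K₀ g₀ os sh h.ge)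

/-- **THE v1.0 TWIN of the step-wise monotonicity.** [cite: Balaban1989LargeFieldII, (1.80) p.384; King1986, (3.10)–(3.11) p.656 (bookkeeping)] -/
theorem W_crOfRecord₁₃At_mono_at {jcut jcut' : ℕ → ℕ} {K : ℕ} (h : jcut K ≤ jcut' K) :
    (crOfRecord₁₃At K₀ jcut sh F θ hP g₀ os).W K ≤ (crOfRecord₁₃At K₀ jcut' sh F θ hP g₀ os).W K :=
  W_crOfRecord₁₃VAt_mono_at θ hP K₀ g₀ os sh h

/-! ## §2  Normal form: above the window the dial is flat -/

/-- **A KEY OF THE CLASS SET AT STEP `K` IS OLD-BAD AT `j` IFF AT `min j (K₀ + K + 1)`**: deeper than `K₀ + K + 1` nothing changes, because at `K₀ + K + 1` the key is already old-bad (CLAIM-1's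
`keyOldLargeField_of_mem_classSet₁₃_of_lt`). [cite: Balaban1988Convergent, (2.18) p.257; Balaban1989LargeFieldII, (1.80) p.384 (bookkeeping)] -/
theorem keyOldLargeField_min_length_succ_iff (K : ℕ) (j : ℕ) {x : Σ K, SiteSeqKey F (K₀ + K)} (hx : x ∈ classSet₁₃ θ K₀ g₀ K) :
    KeyOldLargeField (min j (K₀ + K + 1)) x.2 ↔ KeyOldLargeField j x.2 := by
  refine ⟨fun h => h.mono (min_le_left _ _), fun h => ?_⟩
  rcases le_or_gt j (K₀ + K + 1) with hj | hj
  · rwa [min_eq_left hj]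
  · rw [min_eq_right hj.le]
    exact keyOldLargeField_of_mem_classSet₁₃_of_lt θ K₀ g₀ K (by omega) hx

/-- **THE BAD CLASS DEPENDS ON THE POLICY ONLY THROUGH `min (jcut K) (K₀ + K + 1)`.** [cite: Balaban1989LargeFieldII, (1.80) p.384 (bookkeeping)] -/
theorem badClass₁₃_eq_badClass₁₃_min (jcut : ℕ → ℕ) (K : ℕ) (t : ℝ) :
    badClass₁₃ θ K₀ g₀ jcut K t = badClass₁₃ θ K₀ g₀ (fun K => min (jcut K) (K₀ + K + 1)) K t := by
  ext x
  rw [mem_badClass₁₃_iff, mem_badClass₁₃_iff]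
  exact ⟨fun ⟨hx, h⟩ => ⟨hx, (keyOldLargeField_min_length_succ_iff θ K₀ g₀ K (jcut K) hx).2 h⟩,
    fun ⟨hx, h⟩ => ⟨hx, (keyOldLargeField_min_length_succ_iff θ K₀ g₀ K (jcut K) hx).1 h⟩⟩

/-- **★ THE PERSISTENT-ACTIVITY FRACTION IS FLAT ABOVE THE WINDOW**: `W(jcut) K = W(fun K ↦ min (jcut K) (K₀ + K + 1)) K` — so every policy is equivalent, face-wise, to one cutting at most one
level beyond the run (and CLAIM-1 ∕ CLAIM-2: at that last value the fraction is `1` on a live tuple). [cite: Balaban1989LargeFieldII, (1.80) p.384; King1986, (3.10)–(3.11) p.656 (bookkeeping)] -/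
theorem W_crOfRecord₁₃VAt_eq_W_min (jcut : ℕ → ℕ) (K : ℕ) :
    (crOfRecord₁₃VAt K₀ jcut sh F θ hP g₀ os).W K = (crOfRecord₁₃VAt K₀ (fun K => min (jcut K) (K₀ + K + 1)) sh F θ hP g₀ os).W K := by
  show wInf 1 (classSet₁₃ θ K₀ g₀) (weightA₁₃ θ hP K₀ g₀ os) (weightB₁₃ θ hP K₀ g₀ os) (badClass₁₃ θ K₀ g₀ jcut) K =
    wInf 1 (classSet₁₃ θ K₀ g₀) (weightA₁₃ θ hP K₀ g₀ os) (weightB₁₃ θ hP K₀ g₀ os) (badClass₁₃ θ K₀ g₀ fun K => min (jcut K) (K₀ + K + 1)) K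
  unfold wInf admW
  simp only [badClass₁₃_eq_badClass₁₃_min θ K₀ g₀ jcut K]

/-! ## §3  The N20 face at the reading is ANTITONE in the dial -/

/-- **★★ A DEEPER-CUT WITNESS IS A SHALLOWER-CUT WITNESS**: if `jcut K ≤ jcut' K` for every `K`, the N20 face at `crOfRecord₁₃VAt K₀ jcut' sh …` implies the one at `crOfRecord₁₃VAt K₀ jcut sh …`
(same tuple, canonical weights; CLAIM-2's `relWeightBound_crOfRecord₁₃VAt_iff`, §1, `Summable.of_nonneg_of_le`).  The cut readings carrying N20 at a tuple form a DOWN-SET.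
[cite: Balaban1989LargeFieldII, Thm 1 + (0.1) pp.355–356, (1.80) p.384; King1986, (3.10)–(3.11) p.656 (bookkeeping)] -/
theorem relWeightBound_crOfRecord₁₃VAt_anti {jcut jcut' : ℕ → ℕ} (h : ∀ K, jcut K ≤ jcut' K)
    (h20 : RelWeightBound (crOfRecord₁₃VAt K₀ jcut' sh F θ hP g₀ os).l₀ (crOfRecord₁₃VAt K₀ jcut' sh F θ hP g₀ os).T (crOfRecord₁₃VAt K₀ jcut' sh F θ hP g₀ os).A
      (crOfRecord₁₃VAt K₀ jcut' sh F θ hP g₀ os).B (crOfRecord₁₃VAt K₀ jcut' sh F θ hP g₀ os).Bad (crOfRecord₁₃VAt K₀ jcut' sh F θ hP g₀ os).W) :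
    RelWeightBound (crOfRecord₁₃VAt K₀ jcut sh F θ hP g₀ os).l₀ (crOfRecord₁₃VAt K₀ jcut sh F θ hP g₀ os).T (crOfRecord₁₃VAt K₀ jcut sh F θ hP g₀ os).A
      (crOfRecord₁₃VAt K₀ jcut sh F θ hP g₀ os).B (crOfRecord₁₃VAt K₀ jcut sh F θ hP g₀ os).Bad (crOfRecord₁₃VAt K₀ jcut sh F θ hP g₀ os).W := by
  rw [relWeightBound_crOfRecord₁₃VAt_iff] at h20 ⊢
  refine ⟨fun K => (W_crOfRecord₁₃VAt_mono_at θ hP K₀ g₀ os sh (h K)).trans_lt (h20.1 K),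
    h20.2.of_nonneg_of_le (fun K => wInf_nonneg K) fun K => W_crOfRecord₁₃VAt_mono_at θ hP K₀ g₀ os sh (h K)⟩

/-- **THE v1.0 TWIN of the antitone transfer.** [cite: Balaban1989LargeFieldII, (1.80) p.384; King1986, (3.10)–(3.11) p.656 (bookkeeping)] -/
theorem relWeightBound_crOfRecord₁₃At_anti {jcut jcut' : ℕ → ℕ} (h : ∀ K, jcut K ≤ jcut' K)
    (h20 : RelWeightBound (crOfRecord₁₃At K₀ jcut' sh F θ hP g₀ os).l₀ (crOfRecord₁₃At K₀ jcut' sh F θ hP g₀ os).T (crOfRecord₁₃At K₀ jcut' sh F θ hP g₀ os).A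
      (crOfRecord₁₃At K₀ jcut' sh F θ hP g₀ os).B (crOfRecord₁₃At K₀ jcut' sh F θ hP g₀ os).Bad (crOfRecord₁₃At K₀ jcut' sh F θ hP g₀ os).W) :
    RelWeightBound (crOfRecord₁₃At K₀ jcut sh F θ hP g₀ os).l₀ (crOfRecord₁₃At K₀ jcut sh F θ hP g₀ os).T (crOfRecord₁₃At K₀ jcut sh F θ hP g₀ os).A
      (crOfRecord₁₃At K₀ jcut sh F θ hP g₀ os).B (crOfRecord₁₃At K₀ jcut sh F θ hP g₀ os).Bad (crOfRecord₁₃At K₀ jcut sh F θ hP g₀ os).W :=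
  relWeightBound_crOfRecord₁₃VAt_anti θ hP K₀ g₀ os sh h h20

end Reading

end Summit.QuantumFields.YangMills.BalabanUVNodes.N20KeyedRelWeightDialMonotone

end
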